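import Mathlib.Analysis.Matrix.PosDef
import Mathlib.Analysis.Matrix.Spectrum
import HarnessLib

/-!
# Ventures/CertifiedQuantumChemistry — Rows/InvariantCoverPSD.lean: positive semidefiniteness from
# the reduced blocks of a COMMUTING COVER (the soundness lemma of the symmetry-adapted exact PSD screen)

HONEST FRAMING (verbatim): certified bounds for a stated model Hamiltonian in a stated basis; not a
claim about the real molecule beyond that model. Nothing here asserts a value, a row or a claim node;
the `X_∞` programmes this lemma serves are auxiliary limit programmes, never CERTIFIED rows.

Seat rdm-B (gen 30), zero compute; theorems only (no `def`). Companion of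
`Rows/KernelFacialReduction.lean` (gen 29) and `Rows/ExactEnclosureCertificate.lean` (gen 30). It
types the ONE linear-algebra fact on which the symmetry-adapted twin checker
`pub-qchem-rdmb/tools/x12-g28/x12e/check_enclosure_sym.py` and the exact screens of the primal
constructors (`symlin.BlockSymmetry.split_psd`) rest — in the words of the checker's docstring,
"B PSD ⟺ every `Vᵀ B V` PSD for a B-invariant direct sum":

* `InvariantCover.posSemidef_of_commuting_cover` — if Hermitian `B` COMMUTES with matrices `E_a`
  that SUM TO THE IDENTITY (`Σ_a E_a = 1`; no idempotency, no orthogonality, no symmetry of the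
  `E_a` is needed), and the quadratic form of `B` is nonnegative on the range of every `E_a`, then
  `B ⪰ 0`. Proof: a Hermitian matrix that is not PSD has an eigenvector `v` with eigenvalue `λ < 0`
  (spectral theorem, Mathlib); `v = Σ_a E_a v`, so some `E_a v ≠ 0`, and `B (E_a v) = E_a B v = λ E_a v`
  makes the form negative at `E_a v` — contradiction.
* `InvariantCover.posSemidef_of_reduced_blocks` / `posSemidef_iff_reduced_blocks` — the form the
  checker evaluates: with column bases `V_a` such that `E_a = V_a W_a` (the range of `E_a` lies in the
  column span of `V_a`), `B ⪰ 0 ⟺ ∀ a, V_aᴴ B V_a ⪰ 0` (the "⇒" half is congruence, Mathlib's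
  `PosSemidef.conjTranspose_mul_mul_same`).
* `InvariantCover.reduced_block_eq_of_commute` — TRANSPORT: if `U` is an isometry (`Uᴴ U = 1`)
  commuting with `B` then `(U V)ᴴ B (U V) = Vᴴ B V`; so two pieces of the cover exchanged by such a
  `U` have the SAME reduced block and it is tested once (the checker's "halving" of the
  two-dimensional isotypic types, rank counted twice).

How the checker instantiates it (words, not Lean): per block it builds the rational isotypic
projectors `P_a` of the listed signed permutations `U_g` and VERIFIES EXACTLY `Σ_a P_a = |G|·1`,
`P_a² = |G| P_a`, `P_a P_b = 0`, `P_a U_g = U_g P_a`, and that the tested matrix `B` commutes with every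
`U_g` (hence with every `P_a`, a rational combination of the `U_g`): `E_a := P_a / |G|`, `V_a` = an
independent set of columns of `P_a`. For a two-dimensional type it further splits
`range P_a = S ⊕ U_r S` with `S = range (E₁₁ P_a)`, `E₁₁` in the group algebra of the rotations
(verified: `rank (E₁₁ P_a) = rank P_a / 2` and `[E₁₁ P_a | U_r E₁₁ P_a]` of full rank `rank P_a`);
both summands are `B`-invariant, so the two oblique idempotents of this splitting commute with `B`
and refine the cover, and by the transport lemma the `U_r S` block equals the `S` block. A block
that fails the commutation check falls back to the plain `LDLᵀ` test (no lemma needed).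

Scalars: any `RCLike` field (`ℝ` for the cell's data; `ℂ` identical), Mathlib's `ComplexOrder`
convention for `0 ≤ z`. Everything is PROVED (0 sorry). References (docstring-only): the
block-diagonalisation step of symmetry reduction for semidefinite programmes, e.g. K. Gatermann,
P. A. Parrilo, J. Pure Appl. Algebra 192 (2004) 95, §3; C. Bachoc, D. C. Gijswijt, A. Schrijver,
F. Vallentin, *Invariant semidefinite programs* (2012) §2 (in the tree, in `*`-algebra form:
`Literature/Analysis/Convex/MatrixStarAlgebraPSD.lean`); the eigenvector argument is folklore.
-/

namespace Summit.Ventures.CertifiedQuantumChemistry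

open Matrix
open scoped ComplexOrder

namespace InvariantCover

variable {𝕜 : Type*} [RCLike 𝕜] {n : Type*} [Fintype n] [DecidableEq n] {ι : Type*}

/-- A Hermitian matrix that is NOT positive semidefinite has an eigenvector with a negative
eigenvalue (spectral theorem). [folklore] -/
theorem exists_eigenvector_neg {B : Matrix n n 𝕜} (hB : B.IsHermitian) (h : ¬ B.PosSemidef) :
    ∃ (v : n → 𝕜) (lam : ℝ), v ≠ 0 ∧ lam < 0 ∧ B *ᵥ v = (lam : 𝕜) • v := by
  rw [hB.posSemidef_iff_eigenvalues_nonneg] at h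
  obtain ⟨j, hj⟩ : ∃ j, hB.eigenvalues j < 0 := by
    by_contra h'
    push Not at h'
    exact h fun j => h' j
  refine ⟨⇑(hB.eigenvectorBasis j), hB.eigenvalues j, ?_, hj, ?_⟩
  · exact (WithLp.ofLp_eq_zero 2).ne.2 (hB.eigenvectorBasis.orthonormal.ne_zero j)
  · rw [hB.mulVec_eigenvectorBasis j, RCLike.real_smul_eq_coe_smul (K := 𝕜)]

/-- **PSD FROM A COMMUTING COVER.** Let `B` be Hermitian and let matrices `E_a` (`a ∈ s`) SUM TO
THE IDENTITY and each COMMUTE with `B`. If the quadratic form of `B` is nonnegative on the range of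
every `E_a` — `0 ≤ (E_a x)ᴴ B (E_a x)` for all `x` — then `B ⪰ 0`. No idempotency, orthogonality or
symmetry of the `E_a` is assumed. [folklore; the eigenvector argument] -/
theorem posSemidef_of_commuting_cover {B : Matrix n n 𝕜} (hB : B.IsHermitian)
    (E : ι → Matrix n n 𝕜) (s : Finset ι) (hsum : ∑ a ∈ s, E a = 1)
    (hcomm : ∀ a ∈ s, E a * B = B * E a)
    (hpsd : ∀ a ∈ s, ∀ x : n → 𝕜, 0 ≤ star (E a *ᵥ x) ⬝ᵥ (B *ᵥ (E a *ᵥ x))) :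
    B.PosSemidef := by
  by_contra h
  obtain ⟨v, lam, hne, hlam, hv⟩ := exists_eigenvector_neg hB h
  -- `v` is covered by the pieces `E_a v`, so one of them is nonzero
  have hdec : ∑ a ∈ s, E a *ᵥ v = v := by
    rw [← Matrix.sum_mulVec, hsum, Matrix.one_mulVec]
  obtain ⟨a, ha, hEv⟩ : ∃ a ∈ s, E a *ᵥ v ≠ 0 := by
    by_contra h'
    push Not at h'
    exact hne (by rw [← hdec]; exact Finset.sum_eq_zero h')
  -- that piece is again an eigenvector for `lam` (commutation)
  have hBE : B *ᵥ (E a *ᵥ v) = (lam : 𝕜) • (E a *ᵥ v) := by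
    rw [mulVec_mulVec, ← hcomm a ha, ← mulVec_mulVec, hv, mulVec_smul]
  -- its Rayleigh quotient is `lam < 0`, against the hypothesis on the range of `E_a`
  have h0 := hpsd a ha v
  rw [hBE, dotProduct_smul, smul_eq_mul] at h0
  have hq : 0 < star (E a *ᵥ v) ⬝ᵥ (E a *ᵥ v) := dotProduct_star_self_pos_iff.mpr hEv
  have h0' := (RCLike.nonneg_iff.mp h0).1
  have hq' := (RCLike.pos_iff.mp hq).1
  rw [RCLike.re_ofReal_mul] at h0'
  nlinarith

/-- **PSD FROM THE REDUCED BLOCKS OF A COMMUTING COVER** (the form the checker evaluates). With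
`B` Hermitian, `Σ_{a ∈ s} E_a = 1`, `E_a B = B E_a`, and for each `a` a column matrix `V_a` and a
coefficient matrix `W_a` with `V_a W_a = E_a` (the range of `E_a` lies in the column span of `V_a`):
if every REDUCED BLOCK `V_aᴴ B V_a` is positive semidefinite then so is `B`. [folklore] -/
theorem posSemidef_of_reduced_blocks {B : Matrix n n 𝕜} (hB : B.IsHermitian)
    (E : ι → Matrix n n 𝕜) (s : Finset ι) (hsum : ∑ a ∈ s, E a = 1)
    (hcomm : ∀ a ∈ s, E a * B = B * E a)
    {m : ι → Type*} [∀ a, Fintype (m a)] (V : ∀ a, Matrix n (m a) 𝕜) (W : ∀ a, Matrix (m a) n 𝕜)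
    (hVW : ∀ a ∈ s, V a * W a = E a) (hred : ∀ a ∈ s, ((V a)ᴴ * B * V a).PosSemidef) :
    B.PosSemidef := by
  refine posSemidef_of_commuting_cover hB E s hsum hcomm fun a ha x => ?_
  -- congruence by `W_a` carries the reduced block to `E_aᴴ B E_a`
  have h := (hred a ha).conjTranspose_mul_mul_same (W a)
  have e : (W a)ᴴ * ((V a)ᴴ * B * V a) * W a = (E a)ᴴ * B * E a := by
    rw [← hVW a ha, conjTranspose_mul]
    simp only [Matrix.mul_assoc]
  rw [e] at h
  have hx := h.dotProduct_mulVec_nonneg x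
  rw [← mulVec_mulVec, ← mulVec_mulVec, dotProduct_mulVec, ← star_mulVec] at hx
  exact hx

/-- **THE SCREEN'S EQUIVALENCE**: under the hypotheses of `posSemidef_of_reduced_blocks`,
`B ⪰ 0 ⟺` every reduced block `V_aᴴ B V_a ⪰ 0` (the "⇒" half is plain congruence and needs none of
the cover hypotheses). [folklore] -/
theorem posSemidef_iff_reduced_blocks {B : Matrix n n 𝕜} (hB : B.IsHermitian)
    (E : ι → Matrix n n 𝕜) (s : Finset ι) (hsum : ∑ a ∈ s, E a = 1)
    (hcomm : ∀ a ∈ s, E a * B = B * E a)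
    {m : ι → Type*} [∀ a, Fintype (m a)] (V : ∀ a, Matrix n (m a) 𝕜) (W : ∀ a, Matrix (m a) n 𝕜)
    (hVW : ∀ a ∈ s, V a * W a = E a) :
    B.PosSemidef ↔ ∀ a ∈ s, ((V a)ᴴ * B * V a).PosSemidef :=
  ⟨fun h a _ => h.conjTranspose_mul_mul_same (V a),
    posSemidef_of_reduced_blocks hB E s hsum hcomm V W hVW⟩

omit [DecidableEq n] in
/-- **TRANSPORT** (the "halving"): if `U` is an isometry (`Uᴴ U = 1`) commuting with `B`, the reduced
block of `B` on the columns `U V` equals the one on `V`, `(U V)ᴴ B (U V) = Vᴴ B V`; two pieces of a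
cover exchanged by such a `U` are therefore tested once. [folklore] -/
theorem reduced_block_eq_of_commute [DecidableEq n] {B U : Matrix n n 𝕜} (hU : Uᴴ * U = 1)
    (hUB : U * B = B * U) {m : Type*} (V : Matrix n m 𝕜) :
    (U * V)ᴴ * B * (U * V) = Vᴴ * B * V := by
  rw [conjTranspose_mul]
  calc Vᴴ * Uᴴ * B * (U * V) = Vᴴ * (Uᴴ * (B * U)) * V := by simp only [Matrix.mul_assoc]
    _ = Vᴴ * (Uᴴ * (U * B)) * V := by rw [← hUB]
    _ = Vᴴ * B * V := by rw [← Matrix.mul_assoc Uᴴ U B, hU, Matrix.one_mul]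

end InvariantCover

end Summit.Ventures.CertifiedQuantumChemistry
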